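import Summits.ABC.IUTFork.Cor312VolumesRealDH
import Literature.IUT.LogVolume.LatticeAutBalls
import Literature.IUT.LogVolume.TensorPacketOrbitSpan
import HarnessLib

/-!
# [IUTchIII] Cor. 3.12 support — at a RAMIFIED place the typed (Ind2) group `Real.ismDH` moves balls `λ·𝒪_v` off the
# balls: the hull-frame-automorphism shape of (Ind2) FAILS for the Dupuy–Hilado reading at `e_v ≥ 2`

PROOF-ONLY kernel piece of the abc-iut cell (Cor. 3.12 sub-crew, seat abc-iut-c312-5, gen 4; D-0067 residual «`hst` at the
BAD packets» of abc-iut-w5-d060's `Cor312HullGluedStable` p424693). TAKES NO SIDE on [IUTchIII] Cor. 3.12; no definition,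
no `Prop` fact.

The hull-gluing files reduce the bracket to stability properties of the indeterminacy group acting on HULL-SETS `λ·𝒪_L`
([IUTchIII] Rmk. 3.9.5 (i), kurims `paper:url-4b091feeb646` p. 127) of the real packet frames. In c312-5's setting of
record the (Ind2) slot at a finite place `v` is `Real.ismDH logv (inr v)` = ALL bicontinuous `ℚ`-linear automorphisms of
`K_v` fixing the log-shell `I_v` (Dupuy–Hilado arXiv:2004.13228 §4.9: "`ℚ_p`-vector space automorphisms which arise as
`ℤ_p`-lattice isomorphisms of `I_v`"). abc-iut-w5-d060's `Cor312HullShearWitness` (p425317) showed on the TOY carrier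
`ℚ_p ⊕ ℚ_p` that a lattice automorphism need not map hull-sets to hull-sets. THIS FILE proves it for the GENUINE group at a
GENUINE completion: at a place `v | p` of the number field `F` with ABSOLUTE RAMIFICATION INDEX `e_v ≥ 2` (abc-iut-S7's
`absRamificationIdx` of the rescaled completion `K_v`), for the analytic logarithm (`LogvAnalyticAt`),

* `exists_latticeAut_logUnits_image_closedBall_ne` — some `ℚ_p`-linear automorphism `φ` of `K_v` fixing `log_p(𝒪_v^×)`
  (hence every `c·log_p(𝒪_v^×)`, in particular the log-shell `I_v = (p^*)⁻¹·log_p(𝒪_v^×)`) maps some ball `{‖y‖ ≤ ‖t‖}`,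
  `t ≠ 0` — a hull-set `t·𝒪_v` of the one-factor real frame — onto a set that is NO ball (campaign-S lattice algebra
  `LatticeAutBalls`: if all lattice automorphisms preserved all balls, the value group would miss `(p⁻¹, 1)`, i.e.
  `e_v = 1`; `log_p(𝒪_v^×)` is a basis lattice by `exists_adaptedBasis`);
* **`exists_mem_ismDH_image_closedBall_ne`** — that `φ`, read on c312-5's carrier `Real.Carrier (inr v) = K_v`, IS an
  element of the typed (Ind2) group `Real.ismDH logv (inr v)` (continuous with continuous inverse — finite dimension —
  and fixing `I_v`): **the Dupuy–Hilado (Ind2) at a ramified place does not act by hull-frame automorphisms of the real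
  frame `HullFrame.ofLocalFields`** — the 1-packet core of the seat's finding that the hypotheses `hgen`/`hHul` of
  p419524/p418697 fail at `Real.settingDHVol` for `F ≠ ℚ`, and that one-set stability `hst` of `^{n,∘}𝒰` can fail at the
  packets over ramified primes (there `(Ind2)·𝒪_L` has hull `p⁻¹·𝒪_L` — hand computation on HOME/STATUS, not asserted
  here; the label packets are `(j+1)`-fold tensor packets, `j ≥ 1`, whose kernel treatment needs the idempotent structure
  of `K_v ⊗ K_v` through the chosen decomposition).
Companion POSITIVE result: `Cor312HullStableDHVol` (`hst` HOLDS at every odd `p ∤ disc(F)` for summand-wise scaled boxes).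
[cite: DupuyHilado2025, §4.9] [cite: WeilBNT1967, Ch. II §2, Th. 1] [claim: Mochizuki2012, status: disputed] vocabulary only.
-/

noncomputable section

open Set Metric NumberField IsDedekindDomain
open scoped Pointwise

namespace Summit.ABC

namespace IUTFork

namespace Thm311

namespace Real

open Cor312Vol Literature.IUT.LogThetaLattice Literature.IUT.LogVolume Literature.NumberTheory.NumberFields

variable {F : Type} [Field F] [NumberField F] (p : ℕ) [hp : Fact p.Prime]

/-- **At a place with `e_v ≥ 2`, a `ℚ_p`-linear automorphism of `K_v` fixing `log_p(𝒪_v^×)` (and all its `ℚ_p`-multiples)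
maps some ball `{‖y‖ ≤ ‖t‖}`, `t ≠ 0`, onto a set that is no ball.** (`log_p(𝒪_v^×)` is the lattice of an adapted basis;
campaign-S `exists_latticeAut_image_closedBall_ne`.) [cite: WeilBNT1967, Ch. II §2, Th. 1] [cite: DupuyHilado2025, §4.9] -/
theorem exists_latticeAut_logUnits_image_closedBall_ne (v : HeightOneSpectrum (𝓞 F))
    (hv : ((p : ℕ) : 𝓞 F) ∈ v.asIdeal) (he : 2 ≤ absRamificationIdx p (RescaledCompletion F p v hv)) :
    ∃ φ : RescaledCompletion F p v hv ≃ₗ[ℚ_[p]] RescaledCompletion F p v hv,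
      (∀ c : ℚ_[p], φ '' (c • logUnits (RescaledCompletion F p v hv)) = c • logUnits (RescaledCompletion F p v hv)) ∧
      ∃ t : RescaledCompletion F p v hv, t ≠ 0 ∧
        ∀ μ : RescaledCompletion F p v hv, φ '' closedBall (0 : RescaledCompletion F p v hv) ‖t‖ ≠ closedBall 0 ‖μ‖ := by
  set K := RescaledCompletion F p v hv
  obtain ⟨n, bZ, b, c, hn, -, hM⟩ := exists_adaptedBasis p (logUnitsAddSubgroup p K)
    (isOpen_logUnits p K) (isCompact_logUnits p K)
  haveI : Nonempty (Fin n) := ⟨⟨0, hn⟩⟩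
  -- `log_p(𝒪^×) = L_B` for the rescaled basis `B`
  have hΛ : (logUnits K : Set K) = (PadicModule.basisLattice p (b.unitsSMul c) : Set K) := by
    ext x
    rw [← PadicModule.boxLattice_eq_basisLattice_unitsSMul, SetLike.mem_coe, ← hM x]
    rfl
  obtain ⟨φ, hφ, t, ht, hball⟩ := PadicModule.exists_latticeAut_image_closedBall_ne p (b.unitsSMul c)
    (PadicModule.exists_norm_mem_Ioo_of_two_le_absRamificationIdx p he)
  refine ⟨φ, fun a => ?_, t, ht, hball⟩
  rw [hΛ]
  exact PadicModule.image_smul_basisLattice_of_mem p (b.unitsSMul c) hφ a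

/-- The rescaled completion is finite-dimensional over `ℚ_p` (`log_p(𝒪^×)` spans: an adapted basis is a `ℚ_p`-basis).
[cite: NeukirchANT1999, Ch. II Prop. (5.3)] -/
theorem finiteDimensional_rescaledCompletion (v : HeightOneSpectrum (𝓞 F)) (hv : ((p : ℕ) : 𝓞 F) ∈ v.asIdeal) :
    FiniteDimensional ℚ_[p] (RescaledCompletion F p v hv) := by
  obtain ⟨n, bZ, b, c, -, -, -⟩ := exists_adaptedBasis p (logUnitsAddSubgroup p (RescaledCompletion F p v hv))
    (isOpen_logUnits p _) (isCompact_logUnits p _)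
  exact Module.Finite.of_basis b

/-- **The typed (Ind2) group `Real.ismDH` at a RAMIFIED place does NOT act by hull-frame automorphisms**: for `v | p` with
`e_v ≥ 2` and the analytic logarithm at `p`, there is `g ∈ Real.ismDH logv (inr v)` — a bicontinuous `ℚ`-linear
automorphism of `K_v` fixing the log-shell `I_v` (Dupuy–Hilado §4.9) — and a ball `t·𝒪_v = {‖y‖ ≤ ‖t‖}`, `t ≠ 0` (a hull-set
of the one-factor real frame, [IUTchIII] Rmk. 3.9.5 (i)), whose `g`-image is NO ball. Contrast: the constant-scalar
lattices `c·I_v` ARE fixed (abc-iut-c312-5 `family_image_latticePk`). [cite: DupuyHilado2025, §4.9]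
[claim: Mochizuki2012, status: disputed] -/
theorem exists_mem_ismDH_image_closedBall_ne {logv : PadicLogs F} (hlog : LogvAnalyticAt p logv)
    (v : HeightOneSpectrum (𝓞 F)) (hv : ((p : ℕ) : 𝓞 F) ∈ v.asIdeal)
    (he : 2 ≤ absRamificationIdx p (RescaledCompletion F p v hv)) :
    ∃ g ∈ ismDH logv (.inr v),
      ∃ t : RescaledCompletion F p v hv, t ≠ 0 ∧
        ∀ μ : RescaledCompletion F p v hv,
          (fun a => toR p v hv (g (ofR p v hv a))) '' closedBall (0 : RescaledCompletion F p v hv) ‖t‖ ≠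
            closedBall 0 ‖μ‖ := by
  haveI := finiteDimensional_rescaledCompletion p v hv
  obtain ⟨φ, hφΛ, t, ht, hball⟩ := exists_latticeAut_logUnits_image_closedBall_ne p v hv he
  -- `φ` read on c312-5's carrier (the same type) as a `ℚ`-linear automorphism
  let g₀ : Carrier (.inr v : Place F) →+ Carrier (.inr v : Place F) := φ.toAddEquiv.toAddMonoidHom
  let g : Carrier (.inr v : Place F) ≃ₗ[ℚ] Carrier (.inr v : Place F) :=
    { g₀.toRatLinearMap with
      invFun := φ.symm
      left_inv := φ.left_inv
      right_inv := φ.right_inv }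
  have hφc : Continuous φ := φ.toLinearMap.continuous_of_finiteDimensional
  have hφc' : Continuous φ.symm := φ.symm.toLinearMap.continuous_of_finiteDimensional
  -- the log-shell of the real signature, read in the rescaled field, is `(p^*)⁻¹ • log_p(𝒪^×)`
  have hshell : (shell logv (.inr v) : Set (Carrier (.inr v : Place F))) =
      ((pStar p : ℕ) : ℚ_[p])⁻¹ • (logUnits (RescaledCompletion F p v hv) : Set (RescaledCompletion F p v hv)) :=
    Set.ext fun a => mem_shell_iff_mem_smul_logUnits v hv hlog a
  refine ⟨g, ⟨hφc, hφc', ?_⟩, t, ht, fun μ => ?_⟩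
  · -- `g` fixes `I_v`
    rw [hshell]
    exact hφΛ _
  · exact hball μ

end Real

end Thm311

end IUTFork

end Summit.ABC

end
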